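import Mathlib
import Summits.Ventures.PercRepro.RankLevelSetTriangleStar
import Summits.Ventures.PercRepro.TriangleCapMatroidReduction

/-!
# PercRepro — the gain bound at a vertex-like cocircuit (p3, gen 25; P3-TRIANGLE-CAP.md §10o, LEMMA)

`K` a cocircuit of a finite matroid `M` with (C1), `H = M.E \ K` its hyperplane, `d = |K|`, `|E| = r(E) + ν`.
`K` is **vertex-like** when (V1) no triangle lies inside `K` and (V2) every apex — a point of `H` on a triangle
meeting `K` — lies on exactly one such triangle (the vertex star of a simple graph is the model: the apexes are
the edges inside the neighbourhood).  Then `gain M K ≤ min (C(d,2)) ν`: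
* `gain M K ≤ C(d,2)`: a triangle meeting `K` meets it in exactly two points (circuit–cocircuit intersections are
  never singletons; (V1)), and two triangles through the same pair coincide under (C1) — `gain_le_choose`;
* `gain M K ≤ ν`: by (V2) the apex map is an injection of the triangles meeting `K` into the apex set `A ⊆ H`
  (`gain_le_ncard_apexes`); `A ⊆ cl K` and `r(A) < r(K) ≤ d` since `cl A = cl K` would put `K` inside the flat
  `H` (`closure_compl_eq`, `eRk_apexes_add_one_le_eRk`); nullity is monotone, `ν(H) ≥ |A| − r(A)`, and
  `ν = ν(H) + d − 1` (`eRk_compl_add_one_eq_eRank`) — `ncard_apexes_le_nullity`.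
* **`gain_le_of_vertexLike`** — the two halves; **`ncard_triangles_le_P_of_vertexLike`** — with the landed
  reduction: on any class of `Core3` matroids in which every member with a triangle has a vertex-like cocircuit,
  `T(M) ≤ P_KK ν` (the graph case is `TriangleCapGraph`'s theorem in matroid clothing; the rank-`4` bouquet shows
  the hypothesis is not automatic — the general case is the C-043 candidate lemma).
Axioms: standard.
-/

open scoped Matroid

namespace PercRepro

namespace TriangleCap

namespace Cocirc

open Set

variable {α : Type}

/-- The complement of a cocircuit is not spanning. -/
theorem not_spanning_compl (M : Matroid α) {K : Set α} (hK : M.IsCocircuit K) :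
    ¬ M.Spanning (M.E \ K) :=
  (Matroid.isCocircuit_iff_minimal_compl_nonspanning.1 hK).1

/-- Adding any element of the cocircuit `K` to its complement gives a spanning set. -/
theorem spanning_insert_compl (M : Matroid α) {K : Set α} (hK : M.IsCocircuit K) {e : α} (he : e ∈ K) :
    M.Spanning (insert e (M.E \ K)) := by
  have hKE : K ⊆ M.E := hK.subset_ground
  have hmin := Matroid.isCocircuit_iff_minimal_compl_nonspanning.1 hK
  have hsp : M.Spanning (M.E \ (K \ {e})) := by
    by_contra h
    have hle : K ⊆ K \ {e} := hmin.2 h sdiff_subset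
    exact (hle he).2 (mem_singleton e)
  have hset : M.E \ (K \ {e}) = insert e (M.E \ K) := by
    ext x
    simp only [mem_sdiff, mem_singleton_iff, mem_insert_iff, not_and, not_not]
    constructor
    · rintro ⟨hxE, hx⟩
      by_cases hxK : x ∈ K
      · exact Or.inl (hx hxK)
      · exact Or.inr ⟨hxE, hxK⟩
    · rintro (rfl | ⟨hxE, hxK⟩)
      · exact ⟨hKE he, fun _ => rfl⟩
      · exact ⟨hxE, fun h => absurd h hxK⟩
  rwa [hset] at hsp

/-- The complement of a cocircuit is a flat. -/
theorem closure_compl_eq (M : Matroid α) {K : Set α} (hK : M.IsCocircuit K) :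
    M.closure (M.E \ K) = M.E \ K := by
  refine subset_antisymm (fun e he => ?_) (M.subset_closure _ sdiff_subset)
  have heE : e ∈ M.E := M.closure_subset_ground _ he
  by_contra heH
  have heK : e ∈ K := by
    by_contra h
    exact heH ⟨heE, h⟩
  have hsp := spanning_insert_compl M hK heK
  rw [Matroid.spanning_iff_closure_eq (insert_subset heE sdiff_subset),
    Matroid.closure_insert_eq_of_mem_closure he, ← Matroid.spanning_iff_closure_eq sdiff_subset] at hsp
  exact not_spanning_compl M hK hsp

/-- A triangle meeting the cocircuit `K` but not inside it meets it in exactly two points. -/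
theorem ncard_inter_eq_two (M : Matroid α) [M.Finite] {K : Set α} (hK : M.IsCocircuit K) {T : Set α}
    (hT : T ∈ ThmN.triangles M) (hTH : ¬ T ⊆ M.E \ K) (hTK : ¬ T ⊆ K) : (T ∩ K).ncard = 2 := by
  have hTE : T ⊆ M.E := hT.1.subset_ground
  have hTfin : T.Finite := M.ground_finite.subset hTE
  have hne : (T ∩ K).Nonempty := by
    by_contra h
    rw [not_nonempty_iff_eq_empty] at h
    exact hTH fun x hx => ⟨hTE hx, fun hxK => by
      have : x ∈ T ∩ K := ⟨hx, hxK⟩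
      rw [h] at this
      exact this⟩
  have hnt := hT.1.isCocircuit_inter_nontrivial hK hne
  have h1 : 1 < (T ∩ K).ncard := (one_lt_ncard_iff_nontrivial_and_finite).2 ⟨hnt, hTfin.inter_of_left _⟩
  have h2 : (T ∩ K).ncard < T.ncard := by
    apply ncard_lt_ncard _ hTfin
    refine ⟨inter_subset_left, fun h => hTK fun x hx => (h hx).2⟩
  rw [hT.2] at h2
  omega

/-- **`gain M K ≤ C(|K|, 2)`** under (C1) and (V1): the map `T ↦ T ∩ K` into the two-element subsets of `K`
is injective. -/
theorem gain_le_choose (M : Matroid α) [M.Finite] (hC1 : ∀ L ⊆ M.E, M.eRk L = 2 → L.ncard ≤ 3)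
    {K : Set α} (hK : M.IsCocircuit K) (hV1 : ∀ T ∈ ThmN.triangles M, ¬ T ⊆ K) :
    gain M K ≤ K.ncard.choose 2 := by
  classical
  have hKfin : K.Finite := M.ground_finite.subset hK.subset_ground
  have hTfin : (ThmN.triangles M).Finite :=
    M.ground_finite.finite_subsets.subset (fun C hC => hC.1.subset_ground)
  have hSfin : {C ∈ ThmN.triangles M | ¬ C ⊆ M.E \ K}.Finite := hTfin.subset (fun C hC => hC.1)
  rw [gain, ncard_eq_toFinset_card _ hSfin, ncard_eq_toFinset_card _ hKfin,
    ← Finset.card_powersetCard 2 hKfin.toFinset]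
  -- the map `T ↦ T ∩ K` as a finset
  refine Finset.card_le_card_of_injOn (fun T => (hKfin.inter_of_right T).toFinset) ?_ ?_
  · intro T hT
    simp only [Finset.mem_coe, Finite.mem_toFinset] at hT
    have h2 := ncard_inter_eq_two M hK hT.1 hT.2 (hV1 T hT.1)
    simp only [Finset.mem_coe, Finset.mem_powersetCard]
    refine ⟨fun x hx => ?_, ?_⟩
    · rw [Finite.mem_toFinset] at hx ⊢
      exact hx.2
    · rw [← ncard_eq_toFinset_card _ (hKfin.inter_of_right T)]
      exact h2
  · intro T hT T' hT' hTT'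
    simp only [Finset.mem_coe, Finite.mem_toFinset] at hT hT'
    have hTT'' : T ∩ K = T' ∩ K := by
      have := congrArg (fun s : Finset α => (s : Set α)) hTT'
      simpa only [Finite.coe_toFinset] using this
    by_contra hne
    -- two distinct triangles through the two points of `T ∩ K` contradict (C1)
    have h2 := ncard_inter_eq_two M hK hT.1 hT.2 (hV1 T hT.1)
    obtain ⟨x, hx, y, hy, hxy⟩ := (one_lt_ncard (hKfin.inter_of_right T)).1 (by omega)
    have hxT : T ∈ ThmN.trianglesThrough M x := ⟨hT.1.1, hT.1.2, hx.1⟩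
    have hxT' : T' ∈ ThmN.trianglesThrough M x := ⟨hT'.1.1, hT'.1.2, (hTT''.subset hx).1⟩
    have hint := ThmN.inter_eq_singleton_of_mem_trianglesThrough M hC1 hxT hxT' hne
    have hyT' : y ∈ T' := (hTT''.subset hy).1
    have : y ∈ T ∩ T' := ⟨hy.1, hyT'⟩
    rw [hint] at this
    exact hxy this.symm

/-- The apexes of a cocircuit `K`: the points of `M.E \ K` on a triangle meeting `K`. -/
def apexes (M : Matroid α) (K : Set α) : Set α :=
  {a ∈ M.E \ K | ∃ T ∈ ThmN.triangles M, ¬ T ⊆ M.E \ K ∧ a ∈ T}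

/-- An apex lies in the closure of `K` (on a triangle whose other two points are in `K`). -/
theorem apexes_subset_closure (M : Matroid α) [M.Finite] {K : Set α} (hK : M.IsCocircuit K)
    (hV1 : ∀ T ∈ ThmN.triangles M, ¬ T ⊆ K) : apexes M K ⊆ M.closure K := by
  rintro a ⟨haH, T, hT, hTH, haT⟩
  have hTfin : T.Finite := M.ground_finite.subset hT.1.subset_ground
  -- `T ∩ K = T \ {a}`: both have two elements and the first is contained in the second
  have h2 := ncard_inter_eq_two M hK hT hTH (hV1 T hT)
  have hsub : T ∩ K ⊆ T \ {a} := fun x hx => ⟨hx.1, fun hxa => haH.2 (by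
    rw [mem_singleton_iff] at hxa
    rw [← hxa]; exact hx.2)⟩
  have hcard : (T \ {a}).ncard = 2 := by
    have := ncard_sdiff_singleton_add_one haT hTfin
    rw [hT.2] at this
    omega
  have heq : T ∩ K = T \ {a} :=
    eq_of_subset_of_ncard_le hsub (by rw [h2, hcard]) (hTfin.subset sdiff_subset)
  have hmem := hT.1.mem_closure_sdiff_singleton_of_mem haT
  rw [← heq] at hmem
  exact M.closure_subset_closure inter_subset_right hmem

/-- `r(A) + 1 ≤ r(K)` for the apex set `A` of a cocircuit `K`: `A ⊆ cl K`, and `cl A = cl K` would put `K`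
inside the flat `M.E \ K`. -/
theorem eRk_apexes_add_one_le_eRk (M : Matroid α) [M.Finite] {K : Set α} (hK : M.IsCocircuit K)
    (hV1 : ∀ T ∈ ThmN.triangles M, ¬ T ⊆ K) : M.eRk (apexes M K) + 1 ≤ M.eRk K := by
  have hAH : apexes M K ⊆ M.E \ K := fun a ha => ha.1
  have hAcl := apexes_subset_closure M hK hV1
  have hAfin : (apexes M K).Finite := M.ground_finite.subset (hAH.trans sdiff_subset)
  have hne : M.eRk (apexes M K) ≠ ⊤ := ((M.eRk_le_encard _).trans_lt hAfin.encard_lt_top).ne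
  rw [ENat.add_one_le_iff hne]
  by_contra hle
  rw [not_lt] at hle
  have hcl : M.closure (apexes M K) = M.closure (M.closure K) := by
    refine (Matroid.RankFinite.isRkFinite _).closure_eq_closure_of_subset_of_eRk_ge_eRk hAcl ?_
    rwa [M.eRk_closure_eq]
  rw [M.closure_closure] at hcl
  obtain ⟨e, heK⟩ := hK.nonempty
  have heA : e ∈ M.closure (apexes M K) := by
    rw [hcl]
    exact M.subset_closure K hK.subset_ground heK
  have heH : e ∈ M.E \ K := by
    rw [← closure_compl_eq M hK]
    exact M.closure_subset_closure hAH heA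
  exact heH.2 heK

/-- Under (V1) and (V2), the apex map is an injection of the triangles meeting `K` into the apexes. -/
theorem gain_le_ncard_apexes (M : Matroid α) [M.Finite] {K : Set α} (hK : M.IsCocircuit K)
    (hV1 : ∀ T ∈ ThmN.triangles M, ¬ T ⊆ K)
    (hV2 : ∀ T ∈ ThmN.triangles M, ∀ T' ∈ ThmN.triangles M, ¬ T ⊆ M.E \ K → ¬ T' ⊆ M.E \ K →
      ∀ a, a ∉ K → a ∈ T → a ∈ T' → T = T') :
    gain M K ≤ (apexes M K).ncard := by
  obtain ⟨e₀, he₀⟩ := hK.nonempty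
  haveI : Nonempty α := ⟨e₀⟩
  have hAfin : (apexes M K).Finite := M.ground_finite.subset (fun a ha => ha.1.1)
  rw [gain]
  refine ncard_le_ncard_of_injOn (fun T => Classical.epsilon (fun a => a ∈ T ∧ a ∉ K)) ?_ ?_ hAfin
  · intro T hT
    have hex : ∃ a, a ∈ T ∧ a ∉ K := not_subset.1 (hV1 T hT.1)
    have hspec := Classical.epsilon_spec hex
    exact ⟨⟨hT.1.1.subset_ground hspec.1, hspec.2⟩, T, hT.1, hT.2, hspec.1⟩
  · intro T hT T' hT' heq
    have hex : ∃ a, a ∈ T ∧ a ∉ K := not_subset.1 (hV1 T hT.1)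
    have hex' : ∃ a, a ∈ T' ∧ a ∉ K := not_subset.1 (hV1 T' hT'.1)
    have hspec := Classical.epsilon_spec hex
    have hspec' := Classical.epsilon_spec hex'
    simp only at heq
    rw [heq] at hspec
    exact hV2 T hT.1 T' hT'.1 hT.2 hT'.2 _ hspec'.2 hspec.1 hspec'.1

/-- **`|A| ≤ ν`**: the apexes of a cocircuit `K` number at most the nullity (`r(A) ≤ |K| − 1`, nullity is
monotone, `ν = ν(H) + |K| − 1`). -/
theorem ncard_apexes_le_nullity (M : Matroid α) [M.Finite] {K : Set α} (hK : M.IsCocircuit K)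
    (hV1 : ∀ T ∈ ThmN.triangles M, ¬ T ⊆ K) {ν : ℕ} (hν : M.E.encard = M.eRank + ν) :
    (apexes M K).ncard ≤ ν := by
  have hKE : K ⊆ M.E := hK.subset_ground
  have hEfin := M.ground_finite
  have hKfin : K.Finite := hEfin.subset hKE
  have hHfin : (M.E \ K).Finite := hEfin.subset sdiff_subset
  have hAH : apexes M K ⊆ M.E \ K := fun a ha => ha.1
  have hAfin : (apexes M K).Finite := hHfin.subset hAH
  have hDfin : ((M.E \ K) \ apexes M K).Finite := hHfin.subset sdiff_subset
  -- the rank facts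
  have hrA := eRk_apexes_add_one_le_eRk M hK hV1
  have hrK : M.eRk K ≤ K.encard := M.eRk_le_encard K
  have hrH := eRk_compl_add_one_eq_eRank M hK
  have hsub : M.eRk (M.E \ K) ≤ M.eRk (apexes M K) + ((M.E \ K) \ apexes M K).encard := by
    calc M.eRk (M.E \ K) = M.eRk (apexes M K ∪ ((M.E \ K) \ apexes M K)) := by
          rw [union_sdiff_cancel hAH]
      _ ≤ _ := M.eRk_union_le_eRk_add_encard _ _
  have hHcard : (M.E \ K).encard = (apexes M K).encard + ((M.E \ K) \ apexes M K).encard := by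
    rw [← encard_union_eq disjoint_sdiff_right, union_sdiff_cancel hAH]
  have hEcard : M.E.encard = (M.E \ K).encard + K.encard := by
    rw [← encard_union_eq disjoint_sdiff_left, sdiff_union_of_subset hKE]
  -- to `ℕ`
  have hRne : M.eRank ≠ ⊤ := ((M.eRank_le_encard_ground).trans_lt hEfin.encard_lt_top).ne
  obtain ⟨r, hr⟩ := ENat.ne_top_iff_exists.1 hRne
  have hAne : M.eRk (apexes M K) ≠ ⊤ := ((M.eRk_le_encard _).trans_lt hAfin.encard_lt_top).ne
  obtain ⟨rA, hrA'⟩ := ENat.ne_top_iff_exists.1 hAne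
  have hKne : M.eRk K ≠ ⊤ := ((M.eRk_le_encard _).trans_lt hKfin.encard_lt_top).ne
  obtain ⟨rK, hrK'⟩ := ENat.ne_top_iff_exists.1 hKne
  have hHne : M.eRk (M.E \ K) ≠ ⊤ := ((M.eRk_le_encard _).trans_lt hHfin.encard_lt_top).ne
  obtain ⟨rH, hrH'⟩ := ENat.ne_top_iff_exists.1 hHne
  rw [← hrA', ← hrK'] at hrA
  rw [← hrK', ← hKfin.cast_ncard_eq] at hrK
  rw [← hrH', ← hr] at hrH
  rw [← hrH', ← hrA', ← hDfin.cast_ncard_eq] at hsub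
  rw [← hHfin.cast_ncard_eq, ← hAfin.cast_ncard_eq, ← hDfin.cast_ncard_eq] at hHcard
  rw [hEcard, ← hHfin.cast_ncard_eq, ← hKfin.cast_ncard_eq, ← hr] at hν
  have e1 : rA + 1 ≤ rK := by exact_mod_cast hrA
  have e2 : rK ≤ K.ncard := by exact_mod_cast hrK
  have e3 : rH + 1 = r := by exact_mod_cast hrH
  have e4 : rH ≤ rA + ((M.E \ K) \ apexes M K).ncard := by exact_mod_cast hsub
  have e5 : (M.E \ K).ncard = (apexes M K).ncard + ((M.E \ K) \ apexes M K).ncard := by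
    exact_mod_cast hHcard
  have e6 : (M.E \ K).ncard + K.ncard = r + ν := by exact_mod_cast hν
  omega

/-- **The vertex-like gain bound** (P3-TRIANGLE-CAP.md §10o, LEMMA): under (C1), a cocircuit `K` with no
triangle inside it (V1) and every apex on exactly one triangle meeting `K` (V2) has
`gain M K ≤ min (C(|K|,2)) ν`. -/
theorem gain_le_of_vertexLike (M : Matroid α) [M.Finite] (hC1 : ∀ L ⊆ M.E, M.eRk L = 2 → L.ncard ≤ 3)
    {K : Set α} (hK : M.IsCocircuit K) (hV1 : ∀ T ∈ ThmN.triangles M, ¬ T ⊆ K)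
    (hV2 : ∀ T ∈ ThmN.triangles M, ∀ T' ∈ ThmN.triangles M, ¬ T ⊆ M.E \ K → ¬ T' ⊆ M.E \ K →
      ∀ a, a ∉ K → a ∈ T → a ∈ T' → T = T')
    {ν : ℕ} (hν : M.E.encard = M.eRank + ν) :
    gain M K ≤ min (K.ncard.choose 2) ν :=
  le_min (gain_le_choose M hC1 hK hV1)
    ((gain_le_ncard_apexes M hK hV1 hV2).trans (ncard_apexes_le_nullity M hK hV1 hν))

/-- **The closed form on vertex-like classes.** If every finite matroid of the class with a triangle has a
vertex-like cocircuit, then every finite matroid of the class with `|E| = r(E) + ν` has at most `P_KK ν`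
triangles (the landed reduction with `gain_le_of_vertexLike`). -/
theorem ncard_triangles_le_P_of_vertexLike
    (hVL : ∀ (M : Matroid α) [M.Finite], Core3 M → (ThmN.triangles M).Nonempty →
      ∃ K : Set α, M.IsCocircuit K ∧ (∀ T ∈ ThmN.triangles M, ¬ T ⊆ K) ∧
        (∀ T ∈ ThmN.triangles M, ∀ T' ∈ ThmN.triangles M, ¬ T ⊆ M.E \ K → ¬ T' ⊆ M.E \ K →
          ∀ a, a ∉ K → a ∈ T → a ∈ T' → T = T'))
    (M : Matroid α) [M.Finite] (hM : Core3 M) {ν : ℕ} (hν : M.E.encard = M.eRank + ν) :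
    (ThmN.triangles M).ncard ≤ KK.P ν := by
  refine ncard_triangles_le_P_of_existsGoodCocircuit ?_ M hM hν
  intro M' _ hM' hT ν' hν'
  obtain ⟨K, hK, hV1, hV2⟩ := hVL M' hM' hT
  exact ⟨K, hK, gain_le_of_vertexLike M' hM'.c1 hK hV1 hV2 hν'⟩

end Cocirc

end TriangleCap

end PercRepro
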